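import Summits.AtomisticToContinuum.HydrodynamicLimit.Theses.JParityClosure
import Literature.Probability.Entropy.EntropyInequality

/-!
# Sketch — crux idea `kinetic-slab-entropy-spending` for `JParityClosure.OddContactSymmetry`
(stmt-AtomisticToContinuum-17722), crux-ideate round 1, ideator 1.

Two typed objects:

* `slab_transfer` — the abstract "more collisions than entropy" transfer: a FIXED extensive
  relative-entropy budget `KL(μ_N ‖ ν_N) ≤ C·(N+1)` turns a family of reference large-deviation
  bounds `ν_N(A_{N,K}) ≤ e^{-I_K (N+1)}` whose RATE DIVERGES in the slab length `K` into
  `lim_K limsup_N μ_N(A_{N,K}) = 0` — by the event entropy inequality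
  (`Literature.Probability.Entropy.KipnisLandim1999_A1_8_2_holds`, PROVED in tree) alone, with no
  Gronwall and no smallness of `C`.  (Statement; proof is M-sized bookkeeping over `klDiv`.)
* `SlabOddRate` — the typed BET (T_K) of the card: under the flow-invariant homogeneous Gibbs law
  `localGibbsLaw σ (fun _ => a) (fun _ => 0) (fun _ => θe)`, the per-collision-normalised
  Metropolis-weighted J-odd collision sum over ONE kinetic slab `[0, K·t_N]`, `t_N = (N+1)^{-1/3}`
  (finitely many mean free times), READ AT THE KINETIC MESOSCALE `r = K^{1/4}(N+1)^{-1/3}`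
  (between the mean free path and the slab's diffusive scale `K^{1/2}(N+1)^{-1/3}`), deviates from
  `0` by more than `x` with probability `≤ e^{-M(N+1)}` for EVERY `M`, provided `K ≥ K₀(x, M, …)`:
  the large-deviation rate at speed `N+1` diverges with the slab length.  The let-chain is the
  crux's own (route file `Theses/JParityClosure.lean`, decl `OddContactSymmetry`), with three
  changes: time window `Icc 0 (K t_N)`, normalisation `1/(K (N+1))` (nominal collision count)
  instead of `ε/(N+1)`, reading scale `r_{N,K}` instead of a fixed `r`.
-/

noncomputable section

open MeasureTheory Filter Topology InformationTheory
open scoped ENNReal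

namespace Summit.AtomisticToContinuum.HydrodynamicLimit.Cruxes.OddContactSymmetry.KineticSlab

/-- **Slab transfer ("more collisions than entropy").**  For probability measures `μ_N ≪ ν_N` with an
EXTENSIVE but otherwise arbitrary relative-entropy budget `KL(μ_N ‖ ν_N) ≤ C (N+1)` and events
`A_{N,K}` whose reference probabilities satisfy a large-deviation upper bound at speed `N+1` with a
rate `I K` that DIVERGES along `K → ∞`, one has `μ_N(A_{N,K}) ≤ ε` for all large `K`, eventually in
`N`.  Proof: Kipnis–Landim A1 Prop. 8.2, `μ(A) ≤ (log 2 + KL)/log(1 + 1/ν(A)) ≤ (log 2 + C(N+1))/(I_K (N+1))`.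
[cite: KipnisLandim1999, Appendix 1 Prop. 8.2] -/
theorem slab_transfer {E : ℕ → Type} [∀ N, MeasurableSpace (E N)]
    (μ ν : (N : ℕ) → Measure (E N)) [∀ N, IsProbabilityMeasure (μ N)]
    [∀ N, IsProbabilityMeasure (ν N)] (C : ℝ) (hC : 0 ≤ C)
    (hKL : ∀ N, klDiv (μ N) (ν N) ≤ ENNReal.ofReal (C * ((N : ℝ) + 1)))
    (A : (N : ℕ) → ℕ → Set (E N)) (hA : ∀ N K, MeasurableSet (A N K))
    (I : ℕ → ℝ) (hI : Tendsto I atTop atTop)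
    (hLD : ∀ K, ∀ᶠ N in atTop, ν N (A N K) ≤ ENNReal.ofReal (Real.exp (-(I K * ((N : ℝ) + 1))))) :
    ∀ ε : ℝ, 0 < ε → ∃ K₀ : ℕ, ∀ K, K₀ ≤ K → ∀ᶠ N in atTop, ((μ N) (A N K)).toReal ≤ ε := by
  intro ε hε
  -- choose `K₀` with `I K ≥ L := 2 (C+1)/ε` for `K ≥ K₀`
  set L : ℝ := 2 * (C + 1) / ε with hL
  have hLpos : 0 < L := by rw [hL]; positivity
  obtain ⟨K₀, hK₀⟩ := eventually_atTop.1 (hI.eventually_ge_atTop L)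
  refine ⟨K₀, fun K hK => ?_⟩
  have hIK : L ≤ I K := hK₀ K hK
  have hIKpos : 0 < I K := hLpos.trans_le hIK
  filter_upwards [hLD K] with N hN
  have hN1 : (0 : ℝ) < (N : ℝ) + 1 := by positivity
  have hKLtop : klDiv (μ N) (ν N) ≠ ⊤ := ne_top_of_le_ne_top ENNReal.ofReal_ne_top (hKL N)
  by_cases hν0 : ν N (A N K) = 0
  · -- `μ ≪ ν` forces `μ(A) = 0`
    have hac : μ N ≪ ν N := (klDiv_ne_top_iff.1 hKLtop).1
    rw [hac hν0, ENNReal.toReal_zero]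
    exact hε.le
  · have hKLreal : (klDiv (μ N) (ν N)).toReal ≤ C * ((N : ℝ) + 1) :=
      ENNReal.toReal_le_of_le_ofReal (by positivity) (hKL N)
    have hmain := Literature.Probability.Entropy.KipnisLandim1999_A1_8_2_holds (E N) (μ N) (ν N)
      (A N K) (hA N K) hν0 hKLtop
    -- the reference probability `q` and the denominator
    set q : ℝ := (ν N (A N K)).toReal with hq
    have hqpos : 0 < q := ENNReal.toReal_pos hν0 (measure_ne_top _ _)
    have hqle : q ≤ Real.exp (-(I K * ((N : ℝ) + 1))) :=
      ENNReal.toReal_le_of_le_ofReal (Real.exp_pos _).le hN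
    have hden : I K * ((N : ℝ) + 1) ≤ Real.log (1 + q⁻¹) := by
      have h1 : Real.log q ≤ -(I K * ((N : ℝ) + 1)) := by
        have := Real.log_le_log hqpos hqle
        rwa [Real.log_exp] at this
      have h2 : Real.log q⁻¹ ≤ Real.log (1 + q⁻¹) :=
        Real.log_le_log (inv_pos.2 hqpos) (by linarith [inv_pos.2 hqpos])
      rw [Real.log_inv] at h2
      linarith
    have hdenpos : 0 < I K * ((N : ℝ) + 1) := mul_pos hIKpos hN1
    have hnum : Real.log 2 + (klDiv (μ N) (ν N)).toReal ≤ (C + 1) * ((N : ℝ) + 1) := by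
      have hlog2 : Real.log 2 ≤ 1 := by
        have := Real.log_le_sub_one_of_pos (show (0 : ℝ) < 2 by norm_num)
        linarith
      have hN1' : (1 : ℝ) ≤ (N : ℝ) + 1 := by
        have : (0 : ℝ) ≤ (N : ℝ) := Nat.cast_nonneg N
        linarith
      nlinarith
    have hnum0 : 0 ≤ Real.log 2 + (klDiv (μ N) (ν N)).toReal := by
      have : 0 ≤ Real.log 2 := Real.log_nonneg (by norm_num)
      positivity
    calc ((μ N) (A N K)).toReal
        ≤ (Real.log 2 + (klDiv (μ N) (ν N)).toReal) / Real.log (1 + q⁻¹) := hmain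
      _ ≤ (Real.log 2 + (klDiv (μ N) (ν N)).toReal) / (I K * ((N : ℝ) + 1)) :=
          div_le_div_of_nonneg_left hnum0 hdenpos hden
      _ ≤ (C + 1) * ((N : ℝ) + 1) / (I K * ((N : ℝ) + 1)) :=
          div_le_div_of_nonneg_right hnum hdenpos.le
      _ = (C + 1) / I K := by
          field_simp
      _ ≤ (C + 1) / L := div_le_div_of_nonneg_left (by positivity) hLpos hIK
      _ = ε / 2 := by rw [hL]; field_simp
      _ ≤ ε := by linarith

/-- **BET (T_K), typed: kinetic-slab large-deviation rate divergence for the Metropolis-weighted J-odd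
collision average, under the invariant homogeneous Gibbs law, read at the kinetic mesoscale.**
`∃ η₀ > 0` (density cutoff) such that for constant profiles `(a, 0, θe)`, small `σ`, every flow family,
every continuous `χ`, cutoff `g` vanishing on `[η₀,∞)`, bounded continuous J-odd `Ψ`, bandwidth `ϑ > 0`,
deviation `x > 0` and rate target `M > 0`, there is `K₀` with: for every slab length `K ≥ K₀` and all
large `N`, with `t_N = (N+1)^{-1/3}`, reading scale `r = K^{1/4}(N+1)^{-1/3}`, slab `[0, K t_N]` and the
per-collision normalisation `1/(K(N+1))`,
`G_N {z : x < |X̂_{K}(z)|} ≤ exp(-M (N+1))`, where `X̂_K` is the crux's Metropolis-weighted odd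
collision sum over the slab.  (Everything after `let` is the crux's own chain with the three changes
named in the module docstring.) [conjecture] -/
def SlabOddRate : Prop :=
  ∃ η₀ : ℝ, 0 < η₀ ∧ ∀ (a θe : ℝ), 0 < a → 0 < θe → ∃ σ₀ : ℝ, 0 < σ₀ ∧ ∀ σ : ℝ, 0 < σ → σ < σ₀ →
  ∀ Φ : (N : ℕ) → Literature.Analysis.FluidPDE.HardSphereFlow (Literature.Analysis.FluidPDE.Torus.geometry (Fin 3)) (Literature.MathematicalPhysics.KineticTheory.hsDiameter σ N) (N + 1),
  ∀ χ : UnitAddTorus (Fin 3) → ℝ, Continuous χ → ∀ g : ℝ → ℝ, Continuous g → (∀ b, η₀ ≤ b → g b = 0) →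
  ∀ Ψ : EuclideanSpace ℝ (Fin 3) × EuclideanSpace ℝ (Fin 3) × EuclideanSpace ℝ (Fin 3) → ℝ, Continuous Ψ → (∃ C : ℝ, ∀ q, |Ψ q| ≤ C) →
  (∀ (n v w : EuclideanSpace ℝ (Fin 3)), ‖n‖ = 1 → Ψ (-n, (Literature.Analysis.FluidPDE.reflectVel n (v, w)).1, (Literature.Analysis.FluidPDE.reflectVel n (v, w)).2) = -Ψ (n, v, w)) →
  ∀ ϑ : ℝ, 0 < ϑ → ∀ x M : ℝ, 0 < x → 0 < M → ∃ K₀ : ℕ, ∀ K : ℕ, K₀ ≤ K → ∃ N₀ : ℕ, ∀ N : ℕ, N₀ ≤ N →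
  let ε := Literature.MathematicalPhysics.KineticTheory.hsDiameter σ N
  let G := Literature.Analysis.FluidPDE.Torus.geometry (Fin 3)
  let γ := fun z (s : ℝ) => (Φ N).flow s z
  let tN : ℝ := ((N : ℝ) + 1) ^ (-(1 / 3 : ℝ))
  let r : ℝ := (K : ℝ) ^ (1 / 4 : ℝ) * ((N : ℝ) + 1) ^ (-(1 / 3 : ℝ))
  let bx : UnitAddTorus (Fin 3) → UnitAddTorus (Fin 3) → ℝ := fun y y' => 3 / (Real.pi * r ^ 3) * max (1 - Literature.Analysis.FluidPDE.Torus.euclidDist y y' / r) 0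
  let ρm := fun z s (x₀ : UnitAddTorus (Fin 3)) => ∫ q, bx q.1 x₀ ∂(Literature.Analysis.FluidPDE.empiricalMeasure (γ z s))
  let hm := fun z s (x₀ : UnitAddTorus (Fin 3)) (v : EuclideanSpace ℝ (Fin 3)) => ∫ q, bx q.1 x₀ * Literature.Analysis.FluidPDE.localMaxwellian 1 (ϑ ^ 2) v q.2 ∂(Literature.Analysis.FluidPDE.empiricalMeasure (γ z s))
  let pv := fun z s (i j : Fin (N + 1)) => Literature.Analysis.FluidPDE.reflectVel (G.sepVec (γ z s i).1 (γ z s j).1) ((γ z s i).2, (γ z s j).2)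
  let F := fun z s (i j : Fin (N + 1)) => Real.log (hm z s (γ z s i).1 (pv z s i j).1) + Real.log (hm z s (γ z s i).1 (pv z s i j).2) - Real.log (hm z s (γ z s i).1 (γ z s i).2) - Real.log (hm z s (γ z s i).1 (γ z s j).2)
  let Kc := fun (Fn : Literature.Analysis.FluidPDE.Config (N + 1) (Fin 3) Literature.MathematicalPhysics.KineticTheory.T3 → ℝ → Fin (N + 1) → Fin (N + 1) → ℝ) z => 1 / ((K : ℝ) * ((N : ℝ) + 1)) * ∑ᶠ (s : ℝ) (_ : s ∈ Literature.Analysis.FluidPDE.collisionTimes G ε (γ z) ∩ Set.Icc 0 ((K : ℝ) * tN)), ∑ i : Fin (N + 1), ∑ j : Fin (N + 1), (if i ≠ j ∧ ‖G.sepVec (γ z s i).1 (γ z s j).1‖ = ε then Fn z s i j else 0)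
  let X := fun z => Kc (fun z s i j => χ (γ z s i).1 * g (σ ^ 3 * ρm z s (γ z s i).1) * (Ψ (ε⁻¹ • G.sepVec (γ z s i).1 (γ z s j).1, (pv z s i j).1, (pv z s i j).2) * min 1 (Real.exp (-F z s i j)))) z
  Literature.MathematicalPhysics.KineticTheory.localGibbsLaw σ (fun _ => a) (fun _ => 0) (fun _ => θe) N (Φ N) {z | x < |X z|} ≤ ENNReal.ofReal (Real.exp (-(M * ((N : ℝ) + 1))))

end Summit.AtomisticToContinuum.HydrodynamicLimit.Cruxes.OddContactSymmetry.KineticSlab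

end
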